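import Literature.NumberTheory.Automorphic.HilbertRepSchur
import Mathlib.Analysis.InnerProductSpace.ProdL2
import Mathlib.Analysis.InnerProductSpace.Projection.Basic
import HarnessLib

/-!
# Schur's lemma for invariant linear relations (closable intertwining operators)

Topic `NumberTheory/Automorphic`; sibling of `HilbertRepSchur` (Schur's lemma for bounded
operators commuting with a topologically irreducible unitary representation,
`ContRepresentation.IsTopIrreducible.exists_apply_eq_smul_of_commute`). This file proves the
version of Schur's lemma for *unbounded*, densely or non-densely defined, intertwining operators
in the form in which it is used for the infinitesimal action of the centre `Z(𝔤)` of the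
enveloping algebra on the Gårding space of an irreducible unitary representation (Segal's
theorem that irreducible unitary representations are quasi-simple; Knapp–Vogan (1995),
Introduction, Thm. 0.2 and its Notes; Wallach (1988), 1.2.2; cf. Getz–Hahn (2024), proof of
Thm. 6.5.1, printed p. 192, "admits an infinitesimal character by Schur's lemma"):

* `ContRepresentation.IsTopIrreducible.exists_snd_eq_smul_fst_of_invariant` — let `π` be a
  topologically irreducible unitary representation of a group `G` on a complex Hilbert space `H`
  and `Γ ≤ H × H` a complex linear relation which is `G`-invariant (`(x, y) ∈ Γ ⇒ (π g x, π g y) ∈ Γ`)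
  and whose closure is a graph (`(0, y) ∈ closure Γ ⇒ y = 0`, i.e. `Γ` is the graph of a
  *closable* operator on its domain). Then `Γ` is contained in the graph of a scalar: there is
  `c ∈ ℂ` with `y = c • x` for all `(x, y) ∈ Γ`.

Proof (von Neumann's graph method, Wallach (1988), 1.2.2; Knapp–Vogan, Notes to the
Introduction): in the Hilbert sum `H ⊕₂ H` (`WithLp 2 (H × H)`) the closure `K` of `Γ` and its
orthogonal complement are invariant under the unitary operators `π g ⊕ π g`, so the orthogonal
projection `P` onto `K` commutes with them; the corner operators `u ↦ (P(u, 0))₁` and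
`u ↦ (P(u, 0))₂` are bounded and commute with `π`, hence are scalars `a`, `b` (bounded Schur,
`HilbertRepSchur`). If `a ≠ 0`, then `(u, (b/a) u) ∈ K` for all `u`, and for `(u, w) ∈ Γ` the
difference `(0, w - (b/a) u) ∈ K` forces `w = (b/a) u`. If `a = 0`, then `(0, b u) ∈ K` forces
`b = 0`, so `(u, 0) ⊥ K` for every `u`, whence every `(u', w') ∈ Γ` has `u' = 0` and then
`w' = 0`: `Γ = 0`. Everything here is proved; no definitions.

## References

* A. W. Knapp, D. A. Vogan, *Cohomological Induction and Unitary Representations*, Princeton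
  (1995), Introduction, Thm. 0.2 and Notes [KnappVogan1995].
* N. R. Wallach, *Real Reductive Groups I*, Academic Press (1988), 1.2.2 [WallachRRG1].
* A. Deitmar, S. Echterhoff, *Principles of Harmonic Analysis*, 2nd ed. (2014), Lemma 6.1.7
  [DeitmarEchterhoff2014].
* J. R. Getz, H. Hahn, *An Introduction to Automorphic Representations*, GTM 300 (2024), proof of
  Thm. 6.5.1 (printed p. 192) [GetzHahn2024].
-/

noncomputable section

open scoped InnerProductSpace
open Topology

namespace ContRepresentation

section Graph

variable {G H : Type*} [Group G] [NormedAddCommGroup H] [InnerProductSpace ℂ H] [CompleteSpace H]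
  {π : ContRepresentation ℂ G H}

omit [CompleteSpace H] in
/-- `π g (π g⁻¹ x) = x`. [folklore] -/
theorem apply_apply_inv (π : ContRepresentation ℂ G H) (g : G) (x : H) : π g (π g⁻¹ x) = x := by
  change (π g * π g⁻¹) x = x
  rw [← map_mul, mul_inv_cancel, map_one]
  rfl

omit [CompleteSpace H] in
/-- `π g⁻¹ (π g x) = x`. [folklore] -/
theorem apply_inv_apply (π : ContRepresentation ℂ G H) (g : G) (x : H) : π g⁻¹ (π g x) = x := by
  change (π g⁻¹ * π g) x = x
  rw [← map_mul, inv_mul_cancel, map_one]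
  rfl

/-- For a unitary representation, `⟪π g x, y⟫ = ⟪x, π g⁻¹ y⟫`. [folklore] -/
theorem IsUnitary.inner_map_left (hπ : π.IsUnitary) (g : G) (x y : H) :
    ⟪π g x, y⟫_ℂ = ⟪x, π g⁻¹ y⟫_ℂ := by
  conv_lhs => rw [← apply_apply_inv π g y]
  exact hπ.inner_map_map g x (π g⁻¹ y)

/-- **Schur's lemma for invariant linear relations (closable intertwiners).** Let `π` be a
topologically irreducible unitary representation of `G` on the complex Hilbert space `H`, and
`Γ ≤ H × H` a complex subspace such that `(π g x, π g y) ∈ Γ` whenever `(x, y) ∈ Γ`, and such that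
the closure of `Γ` contains no `(0, y)` with `y ≠ 0`. Then there is a scalar `c` with `y = c • x`
for all `(x, y) ∈ Γ`. (Equivalently: a closable operator, defined on a — not necessarily dense —
invariant subspace and commuting with `π`, is a scalar; Segal, Knapp–Vogan (1995), Introduction,
Thm. 0.2 and Notes; Wallach (1988), 1.2.2. The proof projects orthogonally onto the closure of `Γ`
in `H ⊕₂ H` and applies the bounded Schur lemma to the corners of the projection.)
[cite: KnappVogan1995, Introduction, Thm. 0.2 and Notes] -/
theorem IsTopIrreducible.exists_snd_eq_smul_fst_of_invariant (hirr : π.IsTopIrreducible)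
    (hπ : π.IsUnitary) (Γ : Submodule ℂ (H × H))
    (hinv : ∀ g : G, ∀ x ∈ Γ, (π g x.1, π g x.2) ∈ Γ)
    (hgraph : ∀ y : H, ((0 : H), y) ∈ Γ.topologicalClosure → y = 0) :
    ∃ c : ℂ, ∀ x ∈ Γ, x.2 = c • x.1 := by
  classical
  -- the Hilbert sum `E = H ⊕₂ H` and the transport `e : E ≃L H × H`
  set e : WithLp 2 (H × H) ≃L[ℂ] H × H := WithLp.prodContinuousLinearEquiv 2 ℂ H H with he
  have he_apply : ∀ z : WithLp 2 (H × H), e z = WithLp.ofLp z := fun z ↦ rfl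
  have he_symm : ∀ x : H × H, e.symm x = WithLp.toLp 2 x := fun x ↦ rfl
  -- the closure `K` of `Γ` inside `E`
  set Γ' : Submodule ℂ (WithLp 2 (H × H)) := Γ.map (e.symm : H × H →ₗ[ℂ] WithLp 2 (H × H))
    with hΓ'
  set K : Submodule ℂ (WithLp 2 (H × H)) := Γ'.topologicalClosure with hK
  have hKclosed : IsClosed (K : Set (WithLp 2 (H × H))) := Γ'.isClosed_topologicalClosure
  haveI : CompleteSpace K := hKclosed.completeSpace_coe
  -- membership in `K` is membership of the image in the closure of `Γ`
  have hΓ'_coe : (Γ' : Set (WithLp 2 (H × H))) = e.symm '' (Γ : Set (H × H)) := by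
    rw [hΓ']; exact Submodule.map_coe _ _
  have hK_coe : (K : Set (WithLp 2 (H × H))) = e.symm '' (Γ.topologicalClosure : Set (H × H)) := by
    rw [hK, Submodule.topologicalClosure_coe, hΓ'_coe, Submodule.topologicalClosure_coe]
    exact (e.symm.toHomeomorph.image_closure (Γ : Set (H × H))).symm
  have hmemK : ∀ z : WithLp 2 (H × H), z ∈ K ↔ e z ∈ Γ.topologicalClosure := by
    intro z
    rw [← SetLike.mem_coe, hK_coe]
    constructor
    · rintro ⟨x, hx, rfl⟩
      rw [ContinuousLinearEquiv.apply_symm_apply]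
      exact hx
    · intro hz
      exact ⟨e z, hz, by simp⟩
  have hmemK' : ∀ x : H × H, e.symm x ∈ K ↔ x ∈ Γ.topologicalClosure := by
    intro x
    rw [hmemK, ContinuousLinearEquiv.apply_symm_apply]
  -- the unitary operators `U g = π g ⊕ π g` on `E`
  set U : G → WithLp 2 (H × H) →L[ℂ] WithLp 2 (H × H) := fun g ↦
    (e.symm : H × H →L[ℂ] WithLp 2 (H × H)) ∘L ((π g).prodMap (π g)) ∘L
      (e : WithLp 2 (H × H) →L[ℂ] H × H) with hU
  have hU_apply : ∀ (g : G) (z : WithLp 2 (H × H)),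
      U g z = e.symm (π g (e z).1, π g (e z).2) := fun g z ↦ rfl
  have hU_symm : ∀ (g : G) (x : H × H), U g (e.symm x) = e.symm (π g x.1, π g x.2) := by
    intro g x
    rw [hU_apply, ContinuousLinearEquiv.apply_symm_apply]
  have hU_inv : ∀ (g : G) (z : WithLp 2 (H × H)), U g⁻¹ (U g z) = z := by
    intro g z
    rw [hU_apply g z, hU_symm]
    simp only [apply_inv_apply]
    exact e.symm_apply_apply z
  -- `U g` preserves `Γ'`, `K` and `Kᗮ`
  have hUΓ' : ∀ g, ∀ z ∈ Γ', U g z ∈ Γ' := by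
    intro g z hz
    rw [hΓ', Submodule.mem_map] at hz ⊢
    obtain ⟨x, hx, rfl⟩ := hz
    exact ⟨(π g x.1, π g x.2), hinv g x hx, (hU_symm g x).symm⟩
  have hUK : ∀ g, ∀ z ∈ K, U g z ∈ K := by
    intro g z hz
    have hsub : (U g) '' closure (Γ' : Set (WithLp 2 (H × H))) ⊆
        closure ((U g) '' (Γ' : Set (WithLp 2 (H × H)))) :=
      image_closure_subset_closure_image (U g).continuous
    have hz' : U g z ∈ closure ((U g) '' (Γ' : Set (WithLp 2 (H × H)))) :=
      hsub ⟨z, by rwa [← Submodule.topologicalClosure_coe], rfl⟩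
    rw [← SetLike.mem_coe, hK, Submodule.topologicalClosure_coe]
    refine closure_mono ?_ hz'
    rintro _ ⟨w, hw, rfl⟩
    exact hUΓ' g w hw
  have hinnerU : ∀ (g : G) (z w : WithLp 2 (H × H)), ⟪U g z, w⟫_ℂ = ⟪z, U g⁻¹ w⟫_ℂ := by
    intro g z w
    rw [hU_apply g z, hU_apply g⁻¹ w, he_symm, he_symm, WithLp.prod_inner_apply,
      WithLp.prod_inner_apply]
    simp only [hπ.inner_map_left]
    rfl
  have hUKperp : ∀ g, ∀ z ∈ Kᗮ, U g z ∈ Kᗮ := by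
    intro g z hz
    rw [Submodule.mem_orthogonal'] at hz ⊢
    intro w hw
    rw [hinnerU]
    exact hz _ (hUK g⁻¹ w hw)
  -- the projection onto `K` commutes with `U g`
  set P := K.starProjection with hP
  have hPU : ∀ (g : G) (z : WithLp 2 (H × H)), P (U g z) = U g (P z) := by
    intro g z
    refine Submodule.eq_starProjection_of_mem_orthogonal' (hUK g _ (K.starProjection_apply_mem z))
      (hUKperp g _ (K.sub_starProjection_mem_orthogonal z)) ?_
    rw [← map_add, add_sub_cancel]
  -- the corners `A u = (P(u,0))₁`, `B u = (P(u,0))₂` commute with `π`, hence are scalars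
  set A : H →L[ℂ] H := (ContinuousLinearMap.fst ℂ H H) ∘L (e : WithLp 2 (H × H) →L[ℂ] H × H) ∘L
    P ∘L (e.symm : H × H →L[ℂ] WithLp 2 (H × H)) ∘L (ContinuousLinearMap.inl ℂ H H) with hA
  set B : H →L[ℂ] H := (ContinuousLinearMap.snd ℂ H H) ∘L (e : WithLp 2 (H × H) →L[ℂ] H × H) ∘L
    P ∘L (e.symm : H × H →L[ℂ] WithLp 2 (H × H)) ∘L (ContinuousLinearMap.inl ℂ H H) with hB
  have hA_apply : ∀ u, A u = (e (P (e.symm (u, 0)))).1 := fun u ↦ rfl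
  have hB_apply : ∀ u, B u = (e (P (e.symm (u, 0)))).2 := fun u ↦ rfl
  have heU : ∀ (g : G) (z : WithLp 2 (H × H)), e (U g z) = (π g (e z).1, π g (e z).2) := by
    intro g z
    rw [hU_apply, ContinuousLinearEquiv.apply_symm_apply]
  have hcommA : ∀ g : G, Commute (π g) A := by
    intro g
    refine ContinuousLinearMap.ext fun u ↦ ?_
    change π g (A u) = A (π g u)
    rw [hA_apply, hA_apply]
    have h1 : e.symm (π g u, 0) = U g (e.symm (u, 0)) := by
      rw [hU_symm]; simp
    rw [h1, hPU, heU]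
  have hcommB : ∀ g : G, Commute (π g) B := by
    intro g
    refine ContinuousLinearMap.ext fun u ↦ ?_
    change π g (B u) = B (π g u)
    rw [hB_apply, hB_apply]
    have h1 : e.symm (π g u, 0) = U g (e.symm (u, 0)) := by
      rw [hU_symm]; simp
    rw [h1, hPU, heU]
  obtain ⟨a, ha⟩ := hirr.exists_apply_eq_smul_of_commute hπ hcommA
  obtain ⟨b, hb⟩ := hirr.exists_apply_eq_smul_of_commute hπ hcommB
  -- `(a u, b u)` lies in the closure of `Γ`
  have hPe : ∀ u : H, e (P (e.symm (u, 0))) = (a • u, b • u) := by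
    intro u
    exact Prod.ext (ha u ▸ (hA_apply u).symm) (hb u ▸ (hB_apply u).symm)
  have hab : ∀ u : H, (a • u, b • u) ∈ Γ.topologicalClosure := by
    intro u
    rw [← hPe, ← hmemK]
    exact K.starProjection_apply_mem _
  have hΓle : Γ ≤ Γ.topologicalClosure := Γ.le_topologicalClosure
  by_cases ha0 : a = 0
  · -- `a = 0`: then `b = 0`, `(u, 0) ⊥ K`, and `Γ = 0`
    refine ⟨0, fun x hx ↦ ?_⟩
    have hb0 : ∀ u : H, b • u = 0 := fun u ↦ hgraph _ (by simpa [ha0] using hab u)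
    have hP0 : ∀ u : H, P (e.symm (u, 0)) = 0 := by
      intro u
      apply e.injective
      rw [hPe, ha0, zero_smul, hb0, map_zero, Prod.mk_zero_zero]
    have hperp : ∀ u : H, e.symm (u, 0) ∈ Kᗮ := by
      intro u
      rw [← Submodule.starProjection_apply_eq_zero_iff]
      exact hP0 u
    -- `x.1 = 0`
    have hx1 : x.1 = 0 := by
      have hxK : e.symm x ∈ K := (hmemK' x).2 (hΓle hx)
      have h0 : ⟪e.symm (x.1, 0), e.symm x⟫_ℂ = 0 :=
        Submodule.inner_left_of_mem_orthogonal hxK (hperp x.1)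
      rw [he_symm, he_symm, WithLp.prod_inner_apply] at h0
      simp only [inner_zero_left, add_zero] at h0
      exact inner_self_eq_zero.mp h0
    have hx2 : x.2 = 0 := by
      refine hgraph x.2 (hΓle ?_)
      have : ((0 : H), x.2) = x := Prod.ext hx1.symm rfl
      rw [this]
      exact hx
    rw [hx2, zero_smul]
  · -- `a ≠ 0`: `Γ` lies in the graph of `b / a`
    refine ⟨a⁻¹ * b, fun x hx ↦ ?_⟩
    have h1 : (x.1, (a⁻¹ * b) • x.1) ∈ Γ.topologicalClosure := by
      have h := Submodule.smul_mem _ a⁻¹ (hab x.1)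
      rwa [Prod.smul_mk, smul_smul, smul_smul, inv_mul_cancel₀ ha0, one_smul] at h
    have h2 : ((0 : H), x.2 - (a⁻¹ * b) • x.1) ∈ Γ.topologicalClosure := by
      have h := Submodule.sub_mem _ (hΓle hx) h1
      rwa [Prod.mk_sub_mk, sub_self] at h
    exact sub_eq_zero.mp (hgraph _ h2)

end Graph

end ContRepresentation
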